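import Summits.HubbardSuperconductivity.HubbardSuperconductivity.Theorems.BirGroundStateAverageLRO.Negative.YangCeiling
import Literature.MathematicalPhysics.QuantumLattice.PairFieldCarrierBound
import Literature.MathematicalPhysics.QuantumLattice.HubbardGroundStateDoublonBound

/-!
# Crux `BirGroundStateAverageLRO` (item `stmt-HubbardSuperconductivity-2079`): the carrier ceiling `c ≤ 80 δ + 640/U₂`

The crux (`Theses.BalabanIR.BirGroundStateAverageLRO`, route BalabanIR, target / rank 0) asks, on a
window of couplings `0 < U₁ < U < U₂`, eventually in even `L`, the ground-state-AVERAGE `d`-wave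
pair LRO `c·L⁴·Re tr P ≤ Re tr (P Δ_d† Δ_d)` for the projection `P` onto the ground eigenspace of
`hubbardTorus 2 L 1 U` in the sector `(2⌊(1-δ)L²/2⌋, S^z = 0)`.

Third ceiling on the admissible constant, after Yang's kinematic value `2(1 - δ²)`
(`Negative/YangCeiling.lean`) and the weak-coupling pairing-cost ceiling `10⁵·U₁·log²(4 + 32/√U₁)`
(`Negative/PairingCostUniform.lean`): the **carrier ceiling**. A coherent pair field needs charge
carriers — holes or doubly occupied sites (`Literature/…/PairFieldCarrierBound.lean`:
`⟨Δ_d† Δ_d⟩ ≤ 80 L² ((L² - N + 3)‖ψ‖² + 2⟨N_d⟩)` for EVERY `N`-particle state) — and a repulsive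
ground state has few doublons (`Literature/…/HubbardGroundStateDoublonBound.lean`:
`U ⟨N_d⟩ ≤ 4 N ‖ψ‖²`). Hence:

* `re_trace_groundProj_mul_pairField_le_carrier` — in the crux's `let` vocabulary, for `L ≥ 3`,
  `δ ∈ [0, 1]`, `U > 0`: `Re tr (P Δ_d† Δ_d) ≤ 80 L² (δ L² + 5 + 8 L²/U) · Re tr P`;
* `avgBound_const_le_carrier` — one datum `(δ, U, c, L)` of the crux's inequality forces
  `c ≤ 80 δ + 640/U + 400/L²`;
* `birGroundStateAverageLRO_witness_const_le_carrier_upper` — **every witness `(δ, U₁, U₂, c)` of the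
  crux has `c ≤ 80 δ + 640/U₂`** (the UPPER edge: windows reaching out to strong coupling force
  `c ≲ 80δ`), hence `c ≤ 80 δ + 640/U₁` (`birGroundStateAverageLRO_witness_const_le_carrier`, the
  registered form): the admissible constants tend to `0` at the Mott corner (`δ → 0`, `U → ∞`), where
  Yang's kinematic ceiling stays `≈ 2` and the pairing-cost ceiling is void. Refuted strengthening:
  `not_birGroundStateAverageLRO_with_const_gt_carrier`.

Regime map for the crux after this file: `c ≤ min (2(1-δ²), 80δ + 640/U₂, 10⁵·U₁·log²(4+32/√U₁))`
and no window may touch `U = 0`. Sources: F. C. Zhang, C. Gros, T. M. Rice, H. Shiba, Supercond. Sci.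
Technol. 1 (1988) 36, §2 (Gutzwiller factor `g_t = 2δ/(1+δ)` of the pair amplitude in the doped Mott
insulator — the heuristic whose rigorous kernel is the carrier bound); H. Tasaki, J. Phys. Cond.
Matt. 10 (1998) 4353, §5.1; Scalapino, Phys. Rep. 250 (1995) 329, §2. Folklore finite-dimensional
statements; no named facts, no definitions. Nothing here asserts a Theses decl.
-/

noncomputable section

namespace Summit.HubbardSuperconductivity.HubbardSuperconductivity.Theorems.BirGroundStateAverageLRO.Negative

open Matrix Finset Filter
open Literature.Probability.LatticeModels Literature.MathematicalPhysics.QuantumLattice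
open Summit.HubbardSuperconductivity.HubbardSuperconductivity.Theorems
open scoped ComplexOrder

/-- **Carrier bound on the sector ground eigenspace.** For `L ≥ 3`, `2n ≤ L²`, `U > 0` and the
projection `P` onto the ground eigenspace `E₀ = szSector (2n) 0 ⊓ ker (H - e₀)` of
`H = hubbardTorus 2 L 1 U`: `Re tr (P Δ_d† Δ_d) ≤ 80 L² ((L² - 2n + 3) + 8 · 2n / U) · Re tr P`
(every non-zero vector of `E₀` is a sector ground state; carrier bound + doublon bound per vector,
then `re_trace_projMatrix_mul_le`). Zhang–Gross–Rice–Shiba (1988) §2; Tasaki (1998) §5.1. [folklore] -/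
theorem re_trace_sectorGroundProj_mul_pairField_dWave_le_carrier (L : ℕ) [NeZero L] (hL : 3 ≤ L)
    {U : ℝ} (hU : 0 < U) {n : ℕ} (hn : 2 * n ≤ L ^ 2) :
    (projMatrix ((szSector (2 * n) 0 ⊓ Module.End.eigenspace (Matrix.toLin' (hubbardTorus 2 L 1 U))
        (((hubbardTorus 2 L 1 U).minEnergyOn (szSector (Λ := FermionTorus 2 L) (2 * n) 0) : ℝ) : ℂ)).map
        (Fock.toEuclidean (ι := Orb (FermionTorus 2 L)) :
          Fock (Orb (FermionTorus 2 L)) →ₗ[ℂ]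
            EuclideanSpace ℂ (Finset (Orb (FermionTorus 2 L))))) *
        ((pairField dWaveFormFactor L)ᴴ * pairField dWaveFormFactor L)).trace.re ≤
      80 * (L : ℝ) ^ 2 * (((L : ℝ) ^ 2 - (2 * n : ℕ) + 3) + 8 * (2 * n : ℕ) / U) *
        (projMatrix ((szSector (2 * n) 0 ⊓ Module.End.eigenspace (Matrix.toLin' (hubbardTorus 2 L 1 U))
          (((hubbardTorus 2 L 1 U).minEnergyOn (szSector (Λ := FermionTorus 2 L) (2 * n) 0) : ℝ) : ℂ)).map
          (Fock.toEuclidean (ι := Orb (FermionTorus 2 L)) :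
            Fock (Orb (FermionTorus 2 L)) →ₗ[ℂ]
              EuclideanSpace ℂ (Finset (Orb (FermionTorus 2 L)))))).trace.re := by
  rw [map_toEuclidean_eq]
  refine re_trace_projMatrix_mul_le _ _ _ fun v hv => ?_
  obtain ⟨hS, hE⟩ := Submodule.mem_inf.mp hv
  have hvN : IsNParticle (2 * n) v := ((mem_szSector_iff (2 * n) 0 v).1 hS).1
  have hcar := PairFieldCarrier.re_expect_pairField_dWave_conjTranspose_mul_le_carrier L hvN
  -- the doublon bound (for `v ≠ 0`, a sector ground state; trivial for `v = 0`)
  have hd : U * (star v ⬝ᵥ ((∑ x : FermionTorus 2 L, numberOp x 0 * numberOp x 1 :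
      Matrix (Finset (Orb (FermionTorus 2 L))) (Finset (Orb (FermionTorus 2 L))) ℂ) *ᵥ v)).re ≤
      4 * (2 * n : ℕ) * (star v ⬝ᵥ v).re := by
    by_cases hv0 : v = 0
    · subst hv0
      simp
    · have hgs : IsGroundStateInSector (hubbardTorus 2 L 1 U) (2 * n) 0 v := by
        rw [Module.End.mem_eigenspace_iff, Matrix.toLin'_apply] at hE
        exact ⟨hS, hv0, hE⟩
      exact hubbardTorus_groundState_doublon_le L hL U hn hgs
  have hnorm : 0 ≤ (star v ⬝ᵥ v).re := (Complex.nonneg_iff.1 (dotProduct_star_self_nonneg v)).1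
  have hL2 : (0 : ℝ) < (L : ℝ) ^ 2 := by
    have : (0 : ℝ) < (L : ℝ) := by exact_mod_cast Nat.pos_of_ne_zero (NeZero.ne L)
    positivity
  -- `2 ⟨N_d⟩ ≤ 8 N ‖v‖² / U`
  have hd' : 2 * (star v ⬝ᵥ ((∑ x : FermionTorus 2 L, numberOp x 0 * numberOp x 1 :
      Matrix (Finset (Orb (FermionTorus 2 L))) (Finset (Orb (FermionTorus 2 L))) ℂ) *ᵥ v)).re ≤
      8 * (2 * n : ℕ) / U * (star v ⬝ᵥ v).re := by
    rw [div_mul_eq_mul_div, le_div_iff₀ hU]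
    nlinarith
  calc (star v ⬝ᵥ ((pairField dWaveFormFactor L)ᴴ * pairField dWaveFormFactor L) *ᵥ v).re
      ≤ 80 * (L : ℝ) ^ 2 * (((L : ℝ) ^ 2 - (2 * n : ℕ) + 3) * (star v ⬝ᵥ v).re +
          2 * (star v ⬝ᵥ ((∑ x : FermionTorus 2 L, numberOp x 0 * numberOp x 1 :
            Matrix (Finset (Orb (FermionTorus 2 L))) (Finset (Orb (FermionTorus 2 L))) ℂ) *ᵥ v)).re) := hcar
    _ ≤ 80 * (L : ℝ) ^ 2 * (((L : ℝ) ^ 2 - (2 * n : ℕ) + 3) * (star v ⬝ᵥ v).re +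
          8 * (2 * n : ℕ) / U * (star v ⬝ᵥ v).re) := by gcongr
    _ = _ := by ring

/-- **The carrier ceiling in the crux's vocabulary.** For `L ≥ 3`, `δ ∈ [0, 1]` and `U > 0`, the crux's
data satisfy `Re tr (P Δ_d† Δ_d) ≤ 80 L² (δ L² + 5 + 8 L²/U) · Re tr P`
(`N = 2⌊(1-δ)L²/2⌋ ∈ [(1-δ)L² - 2, (1-δ)L²]`). The inner `let`s are the crux's.
Zhang–Gross–Rice–Shiba (1988) §2; Tasaki (1998) §5.1. [folklore] -/
theorem re_trace_groundProj_mul_pairField_le_carrier (L : ℕ) [NeZero L] (hL : 3 ≤ L) {δ : ℝ}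
    (hδ0 : 0 ≤ δ) (hδ1 : δ ≤ 1) {U : ℝ} (hU : 0 < U) :
    let N : ℕ := 2 * ⌊(1 - δ) * (L : ℝ) ^ 2 / 2⌋₊
    let H := hubbardTorus 2 L 1 U
    let S := szSector (Λ := FermionTorus 2 L) N 0
    let E₀ := S ⊓ Module.End.eigenspace (Matrix.toLin' H) ((H.minEnergyOn S : ℝ) : ℂ)
    let P := projMatrix (E₀.map (Fock.toEuclidean (ι := Orb (FermionTorus 2 L)) :
      Fock (Orb (FermionTorus 2 L)) →ₗ[ℂ] EuclideanSpace ℂ (Finset (Orb (FermionTorus 2 L)))))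
    (P * ((pairField dWaveFormFactor L)ᴴ * pairField dWaveFormFactor L)).trace.re ≤
      80 * (L : ℝ) ^ 2 * (δ * (L : ℝ) ^ 2 + 5 + 8 * (L : ℝ) ^ 2 / U) * P.trace.re := by
  intro N H S E₀ P
  have hNle : (N : ℝ) ≤ (1 - δ) * (L : ℝ) ^ 2 := cast_pairNumber_le hδ1 L
  have hL2 : (0 : ℝ) ≤ (L : ℝ) ^ 2 := by positivity
  have hn : N ≤ L ^ 2 := by
    have h : (N : ℝ) ≤ (L : ℝ) ^ 2 := by nlinarith
    exact_mod_cast h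
  -- `N ≥ (1-δ)L² - 2`
  have hNge : (1 - δ) * (L : ℝ) ^ 2 - 2 ≤ (N : ℝ) := by
    have hfl := Nat.lt_floor_add_one ((1 - δ) * (L : ℝ) ^ 2 / 2)
    have : (N : ℝ) = 2 * (⌊(1 - δ) * (L : ℝ) ^ 2 / 2⌋₊ : ℝ) := by
      simp only [N]; push_cast; ring
    rw [this]
    linarith
  have hP := one_le_re_trace_groundProj_hubbardTorus L 1 U δ (by linarith)
  simp only at hP
  have h1 := re_trace_sectorGroundProj_mul_pairField_dWave_le_carrier L hL hU hn
  refine h1.trans (mul_le_mul_of_nonneg_right ?_ (by linarith))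
  refine mul_le_mul_of_nonneg_left ?_ (by positivity)
  -- `(L² - N + 3) + 8N/U ≤ δ L² + 5 + 8 L²/U`
  have hNU : 8 * (N : ℝ) / U ≤ 8 * (L : ℝ) ^ 2 / U := by
    refine div_le_div_of_nonneg_right ?_ hU.le
    have : (N : ℝ) ≤ (L : ℝ) ^ 2 := by nlinarith
    linarith
  change ((L : ℝ) ^ 2 - (N : ℝ) + 3) + 8 * (N : ℝ) / U ≤ δ * (L : ℝ) ^ 2 + 5 + 8 * (L : ℝ) ^ 2 / U
  linarith

/-- **Tightness by the carrier bound.** If the crux's ground-state-average bound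
`c·L⁴·Re tr P ≤ Re tr (P Δ_d† Δ_d)` holds at ONE datum `(δ, U, c, L)` with `L ≥ 3`, `δ ∈ [0, 1]` and
`U > 0`, then `c ≤ 80 δ + 640/U + 400/L²` (`Re tr P ≥ 1`). Zhang–Gross–Rice–Shiba (1988) §2. [folklore] -/
theorem avgBound_const_le_carrier (L : ℕ) [NeZero L] (hL : 3 ≤ L) {δ U c : ℝ} (hδ0 : 0 ≤ δ)
    (hδ1 : δ ≤ 1) (hU : 0 < U)
    (h : let N : ℕ := 2 * ⌊(1 - δ) * (L : ℝ) ^ 2 / 2⌋₊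
      let H := hubbardTorus 2 L 1 U
      let S := szSector (Λ := FermionTorus 2 L) N 0
      let E₀ := S ⊓ Module.End.eigenspace (Matrix.toLin' H) ((H.minEnergyOn S : ℝ) : ℂ)
      let P := projMatrix (E₀.map (Fock.toEuclidean (ι := Orb (FermionTorus 2 L)) :
        Fock (Orb (FermionTorus 2 L)) →ₗ[ℂ] EuclideanSpace ℂ (Finset (Orb (FermionTorus 2 L)))))
      c * (L : ℝ) ^ 4 * P.trace.re ≤
        (P * ((pairField dWaveFormFactor L)ᴴ * pairField dWaveFormFactor L)).trace.re) :
    c ≤ 80 * δ + 640 / U + 400 / (L : ℝ) ^ 2 := by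
  have hup := re_trace_groundProj_mul_pairField_le_carrier L hL hδ0 hδ1 hU
  have hP := one_le_re_trace_groundProj_hubbardTorus L 1 U δ (by linarith)
  simp only at h hup hP
  set T := (projMatrix ((szSector (2 * ⌊(1 - δ) * (L : ℝ) ^ 2 / 2⌋₊) 0 ⊓
      Module.End.eigenspace (Matrix.toLin' (hubbardTorus 2 L 1 U))
        (((hubbardTorus 2 L 1 U).minEnergyOn (szSector (2 * ⌊(1 - δ) * (L : ℝ) ^ 2 / 2⌋₊) 0) : ℝ) :
          ℂ)).map (Fock.toEuclidean (ι := Orb (FermionTorus 2 L)) :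
      Fock (Orb (FermionTorus 2 L)) →ₗ[ℂ] EuclideanSpace ℂ (Finset (Orb (FermionTorus 2 L)))))).trace.re
    with hT
  have hL0 : (0 : ℝ) < (L : ℝ) := by exact_mod_cast Nat.pos_of_ne_zero (NeZero.ne L)
  have hL2 : (0 : ℝ) < (L : ℝ) ^ 2 := by positivity
  have hTpos : 0 < T := by linarith
  have h1 : c * (L : ℝ) ^ 4 * T ≤
      80 * (L : ℝ) ^ 2 * (δ * (L : ℝ) ^ 2 + 5 + 8 * (L : ℝ) ^ 2 / U) * T := h.trans hup
  have h2 : c * (L : ℝ) ^ 4 ≤ 80 * (L : ℝ) ^ 2 * (δ * (L : ℝ) ^ 2 + 5 + 8 * (L : ℝ) ^ 2 / U) :=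
    le_of_mul_le_mul_right h1 hTpos
  rw [show 80 * δ + 640 / U + 400 / (L : ℝ) ^ 2 =
    (80 * (L : ℝ) ^ 2 * (δ * (L : ℝ) ^ 2 + 5 + 8 * (L : ℝ) ^ 2 / U)) / (L : ℝ) ^ 4 by
      field_simp; ring]
  rw [le_div_iff₀ (by positivity)]
  exact h2

/-- **Every witness of the crux has `c ≤ 80 δ + 640/U₂`** (the carrier ceiling, governed by the
UPPER edge of the window): any `(δ, U₁, U₂, c)` with `δ ∈ (0,1/2)`, `0 < U₁ < U₂` for which the crux's
average bound holds eventually in even `L` at every coupling of `(U₁, U₂)` satisfies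
`c ≤ 80δ + 640/U₂` (take couplings `U ↑ U₂` and even sides `L → ∞` in `avgBound_const_le_carrier`).
In particular a window reaching out to strong coupling forces `c ≲ 80 δ`: the admissible constants
vanish at the Mott corner `δ → 0`, `U → ∞`. Zhang–Gross–Rice–Shiba (1988) §2; Tasaki (1998) §5.1.
[folklore] -/
theorem birGroundStateAverageLRO_witness_const_le_carrier_upper {δ U₁ U₂ c : ℝ}
    (hδ : δ ∈ Set.Ioo (0:ℝ) (1/2)) (hU₁ : 0 < U₁) (hU : U₁ < U₂)
    (h : ∀ U ∈ Set.Ioo U₁ U₂, ∃ L₀ : ℕ, ∀ (L : ℕ) [NeZero L], L₀ ≤ L → Even L →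
      let N : ℕ := 2 * ⌊(1 - δ) * (L : ℝ) ^ 2 / 2⌋₊
      let H := hubbardTorus 2 L 1 U
      let S := szSector (Λ := FermionTorus 2 L) N 0
      let E₀ := S ⊓ Module.End.eigenspace (Matrix.toLin' H) ((H.minEnergyOn S : ℝ) : ℂ)
      let P := projMatrix (E₀.map (Fock.toEuclidean (ι := Orb (FermionTorus 2 L)) :
        Fock (Orb (FermionTorus 2 L)) →ₗ[ℂ] EuclideanSpace ℂ (Finset (Orb (FermionTorus 2 L)))))
      c * (L : ℝ) ^ 4 * P.trace.re ≤
        (P * ((pairField dWaveFormFactor L)ᴴ * pairField dWaveFormFactor L)).trace.re) :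
    c ≤ 80 * δ + 640 / U₂ := by
  have hU₂ : 0 < U₂ := hU₁.trans hU
  by_contra hlt
  push Not at hlt
  set ε : ℝ := c - (80 * δ + 640 / U₂) with hε
  have hεpos : 0 < ε := by linarith
  -- a coupling of the window close to `U₂`: `640/U ≤ 640/U₂ + ε/2`
  set Ustar : ℝ := 1 / (1 / U₂ + ε / 1280) with hUstar
  have hden : 0 < 1 / U₂ + ε / 1280 := by positivity
  have hUstar_lt : Ustar < U₂ := by
    rw [hUstar, div_lt_iff₀ hden]
    have : U₂ * (1 / U₂) = 1 := by field_simp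
    nlinarith
  set U := max Ustar ((U₁ + U₂) / 2) with hUdef
  have hUmem : U ∈ Set.Ioo U₁ U₂ :=
    ⟨lt_of_lt_of_le (by linarith) (le_max_right _ _), max_lt hUstar_lt (by linarith)⟩
  have hU0 : 0 < U := hU₁.trans hUmem.1
  have hUge : Ustar ≤ U := le_max_left _ _
  have hinvU : 1 / U ≤ 1 / U₂ + ε / 1280 := by
    have hUstar_pos : 0 < Ustar := by rw [hUstar]; positivity
    calc 1 / U ≤ 1 / Ustar := one_div_le_one_div_of_le hUstar_pos hUge
      _ = 1 / U₂ + ε / 1280 := by rw [hUstar, one_div_one_div]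
  have h640 : 640 / U ≤ 640 / U₂ + ε / 2 := by
    have := mul_le_mul_of_nonneg_left hinvU (by norm_num : (0:ℝ) ≤ 640)
    have e1 : (640 : ℝ) * (1 / U) = 640 / U := by ring
    have e2 : (640 : ℝ) * (1 / U₂ + ε / 1280) = 640 / U₂ + ε / 2 := by ring
    linarith
  obtain ⟨L₀, hL₀⟩ := h U hUmem
  set m : ℕ := max L₀ (⌈800 / ε⌉₊ + 2) with hm
  haveI : NeZero (2 * m) := ⟨by omega⟩
  have hbound := hL₀ (2 * m) (by omega) (even_two_mul m)
  have hc := avgBound_const_le_carrier (2 * m) (by omega) hδ.1.le (by linarith [hδ.2]) hU0 hbound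
  -- `400/(2m)² ≤ 400/(2m) < ε/2`
  have hmR : (⌈800 / ε⌉₊ : ℝ) + 2 ≤ ((2 * m : ℕ) : ℝ) := by
    have : ⌈800 / ε⌉₊ + 2 ≤ 2 * m := by omega
    exact_mod_cast this
  have hceil : (800 / ε : ℝ) ≤ (⌈800 / ε⌉₊ : ℝ) := Nat.le_ceil _
  have hge1 : (1 : ℝ) ≤ ((2 * m : ℕ) : ℝ) := by
    have : 1 ≤ 2 * m := by omega
    exact_mod_cast this
  have hdiv : 800 / ε < ((2 * m : ℕ) : ℝ) := by linarith
  have h8 : 800 < ε * ((2 * m : ℕ) : ℝ) := by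
    have := (div_lt_iff₀ hεpos).1 hdiv
    linarith
  have hfrac : 400 / ((2 * m : ℕ) : ℝ) ^ 2 < ε / 2 := by
    rw [div_lt_iff₀ (by positivity)]
    nlinarith
  linarith

/-- **Every witness of the crux has `c ≤ 80 δ + 640/U₁`** (the weaker form in the lower edge, which is
the registered one-line statement `carrierWitnessCeiling`; immediate from the `U₂` form since
`U₁ < U₂`). Zhang–Gross–Rice–Shiba (1988) §2. [folklore] -/
theorem birGroundStateAverageLRO_witness_const_le_carrier {δ U₁ U₂ c : ℝ}
    (hδ : δ ∈ Set.Ioo (0:ℝ) (1/2)) (hU₁ : 0 < U₁) (hU : U₁ < U₂)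
    (h : ∀ U ∈ Set.Ioo U₁ U₂, ∃ L₀ : ℕ, ∀ (L : ℕ) [NeZero L], L₀ ≤ L → Even L →
      let N : ℕ := 2 * ⌊(1 - δ) * (L : ℝ) ^ 2 / 2⌋₊
      let H := hubbardTorus 2 L 1 U
      let S := szSector (Λ := FermionTorus 2 L) N 0
      let E₀ := S ⊓ Module.End.eigenspace (Matrix.toLin' H) ((H.minEnergyOn S : ℝ) : ℂ)
      let P := projMatrix (E₀.map (Fock.toEuclidean (ι := Orb (FermionTorus 2 L)) :
        Fock (Orb (FermionTorus 2 L)) →ₗ[ℂ] EuclideanSpace ℂ (Finset (Orb (FermionTorus 2 L)))))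
      c * (L : ℝ) ^ 4 * P.trace.re ≤
        (P * ((pairField dWaveFormFactor L)ᴴ * pairField dWaveFormFactor L)).trace.re) :
    c ≤ 80 * δ + 640 / U₁ := by
  have h2 := birGroundStateAverageLRO_witness_const_le_carrier_upper hδ hU₁ hU h
  have hUU : 640 / U₂ ≤ 640 / U₁ := div_le_div_of_nonneg_left (by norm_num) hU₁ hU.le
  linarith

/-- **Refuted strengthening (constant above the carrier ceiling).** There is NO witness of the crux with
`c > 80δ + 640/U₂`: the crux `BirGroundStateAverageLRO` with the extra clause `80δ + 640/U₂ < c` is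
false — in particular no window of the form `(U₁, U₂)` with `U₂ > 640/(c - 80δ)`.
Zhang–Gross–Rice–Shiba (1988) §2. [folklore] -/
theorem not_birGroundStateAverageLRO_with_const_gt_carrier :
    ¬ ∃ δ ∈ Set.Ioo (0:ℝ) (1/2), ∃ U₁ U₂ c : ℝ, 0 < U₁ ∧ U₁ < U₂ ∧ 80 * δ + 640 / U₂ < c ∧
        ∀ U ∈ Set.Ioo U₁ U₂, ∃ L₀ : ℕ, ∀ (L : ℕ) [NeZero L], L₀ ≤ L → Even L →
          let N : ℕ := 2 * ⌊(1 - δ) * (L : ℝ) ^ 2 / 2⌋₊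
          let H := hubbardTorus 2 L 1 U
          let S := szSector (Λ := FermionTorus 2 L) N 0
          let E₀ := S ⊓ Module.End.eigenspace (Matrix.toLin' H) ((H.minEnergyOn S : ℝ) : ℂ)
          let P := projMatrix (E₀.map (Fock.toEuclidean (ι := Orb (FermionTorus 2 L)) :
            Fock (Orb (FermionTorus 2 L)) →ₗ[ℂ]
              EuclideanSpace ℂ (Finset (Orb (FermionTorus 2 L)))))
          c * (L : ℝ) ^ 4 * P.trace.re ≤
            (P * ((pairField dWaveFormFactor L)ᴴ * pairField dWaveFormFactor L)).trace.re := by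
  rintro ⟨δ, hδ, U₁, U₂, c, hU₁, hU, hc, h⟩
  have := birGroundStateAverageLRO_witness_const_le_carrier_upper hδ hU₁ hU h
  linarith

/-- Registered one-line form (`--supports stmt-HubbardSuperconductivity-2079`, stub
`carrierWitnessCeiling`): every witness `(δ, U₁, U₂, c)` of the crux has `c ≤ 80δ + 640/U₁`.
Zhang–Gross–Rice–Shiba (1988) §2. [folklore] -/
theorem carrierWitnessCeiling : ∀ (δ U₁ U₂ c : ℝ), δ ∈ Set.Ioo (0:ℝ) (1/2) → 0 < U₁ → U₁ < U₂ → (∀ U ∈ Set.Ioo U₁ U₂, ∃ L₀ : ℕ, ∀ (L : ℕ) [NeZero L], L₀ ≤ L → Even L → (let N : ℕ := 2 * ⌊(1 - δ) * (L : ℝ) ^ 2 / 2⌋₊; let H := Literature.MathematicalPhysics.QuantumLattice.hubbardTorus 2 L 1 U; let S := Literature.MathematicalPhysics.QuantumLattice.szSector (Λ := Literature.MathematicalPhysics.QuantumLattice.FermionTorus 2 L) N 0; let E₀ := S ⊓ Module.End.eigenspace (Matrix.toLin' H) ((H.minEnergyOn S : ℝ) : ℂ); let P := Literature.MathematicalPhysics.QuantumLattice.projMatrix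 (E₀.map (Literature.MathematicalPhysics.QuantumLattice.Fock.toEuclidean (ι := Literature.MathematicalPhysics.QuantumLattice.Orb (Literature.MathematicalPhysics.QuantumLattice.FermionTorus 2 L)) : Literature.MathematicalPhysics.QuantumLattice.Fock (Literature.MathematicalPhysics.QuantumLattice.Orb (Literature.MathematicalPhysics.QuantumLattice.FermionTorus 2 L)) →ₗ[ℂ] EuclideanSpace ℂ (Finset (Literature.MathematicalPhysics.QuantumLattice.Orb (Literature.MathematicalPhysics.QuantumLattice.FermionTorus 2 L))))); c * (L : ℝ) ^ 4 * P.trace.re ≤ (P * (Matrix.conjTranspose (Literature.MathematicalPhysics.QuantumLattice.pairField Literature.MathematicalPhysics.QuantumLattice.dWaveFormFactor L) * Literature.MathematicalPhysics.QuantumLattice.pairField Literature.MathematicalPhysics.QuantumLattice.dWaveFormFactor L)).trace.re)) → c ≤ 80 * δ + 640 / U₁ :=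
  fun _ _ _ _ hδ hU₁ hU h => birGroundStateAverageLRO_witness_const_le_carrier hδ hU₁ hU h

end Summit.HubbardSuperconductivity.HubbardSuperconductivity.Theorems.BirGroundStateAverageLRO.Negative
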